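import Summits.CriticalPhenomena.PercolationContinuityZ3.Theorems.Transplant.FKDoubleFanTwoSidedSignsBCertA
import Summits.CriticalPhenomena.PercolationContinuityZ3.Theorems.Transplant.FKDoubleFanTwoSidedSignsBCertB
import Summits.CriticalPhenomena.PercolationContinuityZ3.Theorems.Transplant.FKDoubleFanTwoSidedSignsBCertC
import Summits.CriticalPhenomena.PercolationContinuityZ3.Theorems.Transplant.FKDoubleFanTwoSidedSignsBCertD
import Summits.CriticalPhenomena.PercolationContinuityZ3.Theorems.Transplant.FKDoubleFanTwoSidedConeSCross
import HarnessLib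

/-!
# Double fans `K₂ ∨ P_{m+1}`: the sup-norm bound of the `b`-images and the positivity functional of the two-sided criterion —
# (CL-a)_S ∧ (CL-b)_S, hence the far cross-apex theorem for every middle, from the two cross-positivity conditions ALONE

Helper file (`--supports stmt-CriticalPhenomena-4575`), FK sub-lane `prim-bschramm-fk-3` (gen 41); builds on p205010 (kernel theorem, internal
audit signed; external expert review pending).  No named facts, no sorries; standard axioms.  Memo `bschramm/prim-bschramm-fk-3/FAR-CROSS-XVI.md` §5.

From the sign orthant and the seven bound identities of `…TwoSidedSignsBCertA–D`: **`norm_toFun_imgB_le_ellA`** (`‖imgB‖_∞ ≤ ℓ(imgB)` on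
`Valid × Valid`, `0 ≤ q ≤ 1`), so the functional `e₀ = e0Biv q` of `…OneSidedConeSSigns` (`⟪β, e₀⟫ = ℓ(β)`) is uniformly positive on BOTH image
families; hence (**`hypBS_of_crossPos2'`**, **`hypAS_of_crossPos2'`**, **`hypBS_iff_crossPos2`**, **`hypAS_iff_crossPos2`**) the exact criteria of
`…TwoSidedConeSCross` with the positivity hypotheses discharged (`0 < q < 1`), and (**`negCorr_spokes_cross_far_of_crossPos2'`**) the far cross-apex
theorem for every middle of every weighted double fan from the two local tangency conditions alone — cross-positivity of `T_a` and of `T_b` on the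
closure of the normalised two-sided images against `TSDualS q` (`0 < q < 1`; at `q = 1` the Rayleigh difference vanishes).
[folklore]
-/

noncomputable section

namespace Summit.CriticalPhenomena.PercolationContinuityZ3.Theorems

namespace FK

namespace ThreeApex

/-- **The sup norm of a `b`-image is dominated by `ℓ`**: `‖b‖∞ ≤ b_uv + b_xv + b_yv + b_zv` on `Valid × Valid` (`0 ≤ q ≤ 1`). [folklore] -/
theorem norm_toFun_imgB_le_ellA {q : ℝ} {G w : V5} (hq0 : 0 ≤ q) (hq1 : q ≤ 1) (hG : Valid q G) (hw : Valid q w) :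
    ‖Biv.toFun (imgB q G w)‖ ≤ ellA (imgB q G w) := by
  have s1 := imgB_ux_nonneg hq0 hq1 hG hw; have s2 := imgB_uy_nonneg hq0 hq1 hG hw; have s3 := imgB_uz_nonpos hq0 hq1 hG hw
  have s4 := imgB_uv_nonneg hq0 hq1 hG hw; have s5 := imgB_xz_nonpos hq0 hq1 hG hw; have s6 := imgB_xv_nonneg hq0 hq1 hG hw
  have s7 := imgB_yz_nonpos hq0 hq1 hG hw; have s8 := imgB_yv_nonneg hq0 hq1 hG hw; have s9 := imgB_zv_nonneg hq0 hq1 hG hw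
  have b1 := ellA_sub_imgB_ux hq0 hq1 hG hw; have b2 := ellA_sub_imgB_uy hq0 hq1 hG hw; have b3 := ellA_add_imgB_uz hq0 hq1 hG hw
  have b4 := ellA_add_imgB_xz hq0 hq1 hG hw; have b5 := ellA_add_imgB_yz hq0 hq1 hG hw; have b6 := ellA_sub_imgB_xy hq0 hq1 hG hw
  have b7 := ellA_add_imgB_xy hq0 hq1 hG hw
  have h : 0 ≤ ellA (imgB q G w) := by simp only [ellA]; linarith
  simp only [ellA] at *
  refine Biv.norm_toFun_le _ h ?_ ?_ ?_ ?_ ?_ ?_ ?_ ?_ ?_ ?_ <;> rw [abs_le] <;> constructor <;> linarith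

/-- `e₀` is uniformly positive on the `a`-images over `InS` (`c = 1`; `0 ≤ q < 1`). [folklore] -/
theorem hposA_e0Biv {q : ℝ} (hq0 : 0 ≤ q) (hq1 : q < 1) :
    ∀ F w : V5, InS q F → InS q w → 1 * ‖Biv.toFun (imgA q F w)‖ ≤ pairH q (imgA q F w) (e0Biv q) := fun F w hF hw => by
  rw [one_mul, pairH_e0Biv hq1]; exact norm_toFun_imgA_le_ellA hq0 hq1.le hF.valid hw.valid

/-- `e₀` is uniformly positive on the `b`-images over `InS` (`c = 1`; `0 ≤ q < 1`). [folklore] -/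
theorem hposB_e0Biv {q : ℝ} (hq0 : 0 ≤ q) (hq1 : q < 1) :
    ∀ G w : V5, InS q G → InS q w → 1 * ‖Biv.toFun (imgB q G w)‖ ≤ pairH q (imgB q G w) (e0Biv q) := fun G w hG hw => by
  rw [one_mul, pairH_e0Biv hq1]; exact norm_toFun_imgB_le_ellA hq0 hq1.le hG.valid hw.valid

/-- **`HypBS` from cross-positivity of `T_b` alone** (`0 < q < 1`). [folklore] -/
theorem hypBS_of_crossPos2' {q : ℝ} (hq0 : 0 < q) (hq1 : q < 1)
    (hcross : ∀ v ∈ atomClosure2 q, ∀ ρ : Biv, TSDualS q ρ → pairH q (Biv.ofFun v) ρ = 0 → 0 ≤ pairH q (opTb (Biv.ofFun v)) ρ) :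
    HypBS q :=
  hypBS_of_crossPos2 hq0 hq1.le (e0Biv q) one_pos (hposA_e0Biv hq0.le hq1) (hposB_e0Biv hq0.le hq1) hcross

/-- **`HypAS` from cross-positivity of `T_a` alone** (`0 < q < 1`). [folklore] -/
theorem hypAS_of_crossPos2' {q : ℝ} (hq0 : 0 < q) (hq1 : q < 1)
    (hcross : ∀ v ∈ atomClosure2 q, ∀ ρ : Biv, TSDualS q ρ → pairH q (Biv.ofFun v) ρ = 0 → 0 ≤ pairH q (opTa (Biv.ofFun v)) ρ) :
    HypAS q :=
  hypAS_of_crossPos2 hq0 hq1.le (e0Biv q) one_pos (hposA_e0Biv hq0.le hq1) (hposB_e0Biv hq0.le hq1) hcross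

/-- **The exact criterion for (CL-b)_S** (`0 < q < 1`). [folklore] -/
theorem hypBS_iff_crossPos2 {q : ℝ} (hq0 : 0 < q) (hq1 : q < 1) :
    HypBS q ↔ ∀ v ∈ atomClosure2 q, ∀ ρ : Biv, TSDualS q ρ → pairH q (Biv.ofFun v) ρ = 0 → 0 ≤ pairH q (opTb (Biv.ofFun v)) ρ :=
  ⟨crossPosB_of_hypBS hq0 hq1.le, hypBS_of_crossPos2' hq0 hq1⟩

/-- **The exact criterion for (CL-a)_S** (`0 < q < 1`). [folklore] -/
theorem hypAS_iff_crossPos2 {q : ℝ} (hq0 : 0 < q) (hq1 : q < 1) :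
    HypAS q ↔ ∀ v ∈ atomClosure2 q, ∀ ρ : Biv, TSDualS q ρ → pairH q (Biv.ofFun v) ρ = 0 → 0 ≤ pairH q (opTa (Biv.ofFun v)) ρ :=
  ⟨crossPosA_of_hypAS hq0 hq1.le, hypAS_of_crossPos2' hq0 hq1⟩

open MeasureTheory Literature.Probability.LatticeModels Literature.Probability.Percolation
open scoped Classical

variable {V : Type*} [Fintype V]

section Setting

variable {a b : V} {c : ℕ → V} {m : ℕ}
variable (hab : a ≠ b) (hinj : ∀ j k, j ≤ m → k ≤ m → c j = c k → j = k) (hca : ∀ j, j ≤ m → c j ≠ a) (hcb : ∀ j, j ≤ m → c j ≠ b)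
include hab hinj hca hcb

/-- **THE FAR CROSS-APEX THEOREM FOR EVERY MIDDLE FROM THE TWO LOCAL TANGENCY CONDITIONS ALONE** (`0 < q ≤ 1`): if `T_a` and `T_b` are
cross-positive on the closure of the normalised two-sided images against `TSDualS q` (the exact content of (CL-a)_S ∧ (CL-b)_S; vacuous demand at
`q = 1`, where the Rayleigh difference vanishes), then every cross-apex pair `(a c_j, b c_k)`, `j < k ≤ m`, of every weighted double fan is
negatively correlated. [folklore] -/
theorem negCorr_spokes_cross_far_of_crossPos2' (hcard : Fintype.card V = m + 3) {q : ℝ} (hq0 : 0 < q) (hq1 : q ≤ 1)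
    (w : Sym2 V → unitInterval) (hsupp : ∀ e, e ∉ dfPairs a b c m → w e = 0)
    (hcrossA : q < 1 → ∀ v ∈ atomClosure2 q, ∀ ρ : Biv, TSDualS q ρ → pairH q (Biv.ofFun v) ρ = 0 → 0 ≤ pairH q (opTa (Biv.ofFun v)) ρ)
    (hcrossB : q < 1 → ∀ v ∈ atomClosure2 q, ∀ ρ : Biv, TSDualS q ρ → pairH q (Biv.ofFun v) ρ = 0 → 0 ≤ pairH q (opTb (Biv.ofFun v)) ρ)
    {j k : ℕ} (hjk : j < k) (hk : k ≤ m) :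
    (rcMeasureW w q ∅).real ({ω : BondConfig V | s(a, c j) ∈ ω} ∩ {ω | s(b, c k) ∈ ω}) ≤
      (rcMeasureW w q ∅).real {ω : BondConfig V | s(a, c j) ∈ ω} * (rcMeasureW w q ∅).real {ω : BondConfig V | s(b, c k) ∈ ω} := by
  rcases eq_or_lt_of_le hq1 with h1 | h1
  · subst h1
    refine negCorr_spokes_cross_far_of_inKE hab hinj hca hcb hcard one_pos w hsupp ?_ hjk hk
    intro mids _ rd _ _ u s _ _
    rw [rayleigh_crossFar_one]
  · exact negCorr_spokes_cross_far_of_hypABS hab hinj hca hcb hcard hq0 hq1 w hsupp (hypAS_of_crossPos2' hq0 h1 (hcrossA h1))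
      (hypBS_of_crossPos2' hq0 h1 (hcrossB h1)) hjk hk

end Setting

end ThreeApex

end FK

end Summit.CriticalPhenomena.PercolationContinuityZ3.Theorems
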